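import Summits.Schanuel.Schanuel.Theorems.ZilberEacParamCycleBranch
import Summits.Schanuel.Schanuel.Theorems.ZilberEacParamFibreCurveResidual
import Summits.Schanuel.Schanuel.Theorems.ZilberEacParamSurfaceDictionary
import HarnessLib

/-!
# Polynomially parametrised base curves, LXXIX: MANTOVA–MASSER'S DENSITY QUESTION DECIDED OVER
# EVERY POLYNOMIAL CURVE WITH `deg g₀ ≠ deg g₁`, `min ≥ 2` — non-dense ⟹ a constant fibre

HONEST FRAMING.  Cell `pub-schanuel` (Zilber's Exponential-Algebraic Closedness, case ladder;
host summit Schanuel), seat 2, gen 27.  Mantova–Masser (PLMS 2024, §1 p. 5) ask whether the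
UNPROJECTED exponential points of a surface `W ⊆ ℂ² × (ℂˣ)²` of their case (dim-π-S-1-free) are
Zariski dense in `W`.  Gens 19–21 decided it over polynomially parametrised base curves
`C = {(g₀(t), g₁(t))}`, `2 ≤ d = deg g₀ < n = deg g₁`, under a phase / sub-leading / gap condition,
and typed the residual class (`paramFibreCurve_residual_of_not_unprojectedDense`: `d ∣ n`, vanishing
phase, no gap, fibre curves `Q ∈ ℂ[t, y₀]` whose top `t`-row reaches both extreme `y₀`-columns —
the equimodular class).  Gen 27 (files LXXIV–LXXVIII) ported gen 26's transcendence method to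
these bases.  This file assembles:
* **`unprojectedDense_paramSurface₃_of_y0_of_involves_t`** — `2 ≤ d < n`, `Q ∈ ℂ[t, y₀]`
  irreducible with two `y₀`-degrees AND A MONOMIAL INVOLVING `t` ⟹ `S(g; Q)` is dense — NO phase
  condition;
* **`paramSurface₃_support_of_not_dense`** — `2 ≤ d < n`, `Q ∈ ℂ[t, y₀, y₁]` irreducible with a zero
  in `(ℂˣ)²` over infinitely many `t`: if `S(g; Q)` is NOT dense then `Q ∈ ℂ[y₀]` (a constant fibre
  `y₀ = θ`);
* **`mmCase_paramBase_complete`** — THE ANSWER over `C` with `2 ≤ deg g₀ < deg g₁`: a `W` of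
  Mantova–Masser's case with base curve `C` and WITHOUT Zariski-dense exponential points is a
  constant-fibre cylinder `C × {Q(y₀) = 0}`; **`mmCase_paramBase_complete_of_gt`** — the mirror
  (`2 ≤ deg g₁ < deg g₀`: then `Q ∈ ℂ[y₁]`);
* the example **`{x₀ = y₀², x₁ = i y₀⁴ + y₀}`** (`(t², i t⁴ + t)`: `2 ∣ 4`, vanishing phase
  `Re(i · i²) = 0`, no gap `deg(g₁ - i g₀²) = 1 ≤ 2` — a member of the former residual class): in the
  case ∧ DENSE.
What stays OPEN over polynomial curves (precisely): the constant fibres `y₀ = θ` in the residual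
regime (over GRAPHS `deg g₀ = 1` they can fail: `{x₁ = x₀²/(2πi), y₀ = 1}`; over `d ≥ 2` the cycle
at infinity has `log(ψ/θ) ≡ 0`, so the transcendence method is silent and a Puiseux-phase analysis is
needed); equal degrees with real leading ratio beyond gen 20's curvature condition; general algebraic
base curves; Fib(3,2); EC(3,2) — all OPEN; NOT Schanuel's conjecture (neither used nor implied);
EAC ⇏ SC.
-/

noncomputable section

open Filter Topology Set Complex MvPolynomial
open Literature.NumberTheory.Transcendental Literature.ModelTheory.Zilber
open Literature.ModelTheory.ExponentialFields

set_option linter.dupNamespace false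

namespace Summit.Schanuel.Schanuel.Theorems

/-! ## Part A. Support transfer along `ℂ[t, y₀] ↪ ℂ[t, y₀, y₁]` -/

section Transfer

variable {P : MvPolynomial (Fin 2) ℂ}

/-- `∀` over the support of the lift `P̃` is `∀` over the support of `P` (coordinates `0, 1`). -/
theorem forall_support_rename_castSucc_iff (Φ : ℕ → ℕ → Prop) :
    (∀ m ∈ (rename (Fin.castSucc : Fin 2 → Fin 3) P).support, Φ (m 0) (m 1)) ↔
      ∀ v ∈ P.support, Φ (v 0) (v 1) := by
  classical
  have hinj := Fin.castSucc_injective 2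
  have e0 : ∀ v : Fin 2 →₀ ℕ, Finsupp.mapDomain Fin.castSucc v (0 : Fin 3) = v 0 := fun v =>
    Finsupp.mapDomain_apply hinj v (0 : Fin 2)
  have e1 : ∀ v : Fin 2 →₀ ℕ, Finsupp.mapDomain Fin.castSucc v (1 : Fin 3) = v 1 := fun v =>
    Finsupp.mapDomain_apply hinj v (1 : Fin 2)
  rw [support_rename_of_injective hinj, Finset.forall_mem_image]
  refine forall₂_congr fun v _ => ?_
  rw [e0, e1]

/-- `∃` over the support of the lift `P̃` is `∃` over the support of `P` (coordinates `0, 1`). -/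
theorem exists_support_rename_castSucc_iff (Φ : ℕ → ℕ → Prop) :
    (∃ m ∈ (rename (Fin.castSucc : Fin 2 → Fin 3) P).support, Φ (m 0) (m 1)) ↔
      ∃ v ∈ P.support, Φ (v 0) (v 1) := by
  constructor
  · intro h
    by_contra hne
    push Not at hne
    obtain ⟨m, hm, hΦ⟩ := h
    exact ((forall_support_rename_castSucc_iff (fun a b => ¬ Φ a b)).2 hne) m hm hΦ
  · intro h
    by_contra hne
    push Not at hne
    obtain ⟨v, hv, hΦ⟩ := h
    exact ((forall_support_rename_castSucc_iff (fun a b => ¬ Φ a b)).1 hne) v hv hΦ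

end Transfer

/-! ## Part B. Fibre curves involving `t`: dense, with no phase condition -/

section Main

variable (g₀ g₁ : Polynomial ℂ) {Q : MvPolynomial (Fin 3) ℂ}

/-- **Fibre curves involving `t` over a polynomial curve with `2 ≤ deg g₀ < deg g₁` are dense — no
phase condition.**  `Q ∈ ℂ[t, y₀]` irreducible with two monomials of different `y₀`-degree and a
monomial involving `t` ⟹ `I(S ∩ Γ_exp) = I(S)` for `S = S(g; Q)`.
[cite: MantovaMasser2023, §1 Further remarks, p. 5 (the question, open in general)] (new) -/
theorem unprojectedDense_paramSurface₃_of_y0_of_involves_t (hd : 2 ≤ g₀.natDegree)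
    (hlt : g₀.natDegree < g₁.natDegree) (hirr : Irreducible Q) (hQ2 : ∀ m ∈ Q.support, m 2 = 0)
    (h1 : ∃ m ∈ Q.support, ∃ m' ∈ Q.support, m 1 ≠ m' 1) (hx : ∃ m ∈ Q.support, m 0 ≠ 0) :
    UnprojectedDense {w : Fin 2 ⊕ Fin 2 → ℂ | ∃ t : ℂ, w (Sum.inl 0) = g₀.eval t ∧
      w (Sum.inl 1) = g₁.eval t ∧
      MvPolynomial.eval (Fin.cases t (fun i => w (Sum.inr i)) : Fin 3 → ℂ) Q = 0} := by
  by_contra hnot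
  obtain ⟨-, -, -, hR, hL, -⟩ :=
    paramFibreCurve_residual_of_not_unprojectedDense g₀ g₁ hd hlt hirr hQ2 h1 hnot
  obtain ⟨P, rfl⟩ := exists_rename_castSucc_eq hQ2
  have hirr₂ : Irreducible P := irreducible_of_rename_castSucc hirr
  -- transfer the support conditions to `P`
  have h1' : ∃ v ∈ P.support, ∃ v' ∈ P.support, v 1 ≠ v' 1 := by
    obtain ⟨m, hm, m', hm', hne⟩ := h1
    obtain ⟨v, hv, hvm⟩ := (exists_support_rename_castSucc_iff (fun _ b => b = m 1)).1 ⟨m, hm, rfl⟩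
    obtain ⟨v', hv', hvm'⟩ :=
      (exists_support_rename_castSucc_iff (fun _ b => b = m' 1)).1 ⟨m', hm', rfl⟩
    exact ⟨v, hv, v', hv', by rw [hvm, hvm']; exact hne⟩
  have hx' : ∃ v ∈ P.support, v 0 ≠ 0 :=
    (exists_support_rename_castSucc_iff (fun a _ => a ≠ 0)).1 hx
  have hR' : ∀ v₀ ∈ P.support, (∀ v ∈ P.support, v 0 ≤ v₀ 0) →
      (∀ v ∈ P.support, v 0 = v₀ 0 → v 1 ≤ v₀ 1) → ∀ v ∈ P.support, v 1 ≤ v₀ 1 := by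
    intro v₀ hv₀ hmax htop
    obtain ⟨m₀, hm₀, hm₀0, hm₀1⟩ :=
      (exists_support_rename_castSucc_iff (fun a b => a = v₀ 0 ∧ b = v₀ 1)).2 ⟨v₀, hv₀, rfl, rfl⟩
    have h := hR m₀ hm₀
      ((forall_support_rename_castSucc_iff (fun a _ => a ≤ m₀ 0)).2 (by rw [hm₀0]; exact hmax))
      ((forall_support_rename_castSucc_iff (fun a b => a = m₀ 0 → b ≤ m₀ 1)).2
        (by rw [hm₀0, hm₀1]; exact htop))
    have h' := (forall_support_rename_castSucc_iff (fun _ b => b ≤ m₀ 1)).1 h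
    rw [hm₀1] at h'
    exact h'
  have hL' : ∀ v₀ ∈ P.support, (∀ v ∈ P.support, v 0 ≤ v₀ 0) →
      (∀ v ∈ P.support, v 0 = v₀ 0 → v₀ 1 ≤ v 1) → ∀ v ∈ P.support, v₀ 1 ≤ v 1 := by
    intro v₀ hv₀ hmax htop
    obtain ⟨m₀, hm₀, hm₀0, hm₀1⟩ :=
      (exists_support_rename_castSucc_iff (fun a b => a = v₀ 0 ∧ b = v₀ 1)).2 ⟨v₀, hv₀, rfl, rfl⟩
    have h := hL m₀ hm₀
      ((forall_support_rename_castSucc_iff (fun a _ => a ≤ m₀ 0)).2 (by rw [hm₀0]; exact hmax))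
      ((forall_support_rename_castSucc_iff (fun a b => a = m₀ 0 → m₀ 1 ≤ b)).2
        (by rw [hm₀0, hm₀1]; exact htop))
    have h' := (forall_support_rename_castSucc_iff (fun _ b => m₀ 1 ≤ b)).1 h
    rw [hm₀1] at h'
    exact h'
  rw [← paramFibreCurveSurface_eq] at hnot
  exact hnot (unprojectedDense_param_fibreCurve_of_support g₀ g₁ (by omega) hlt hirr₂ h1' hx' hR' hL')

/-- **Over a polynomial curve with `2 ≤ deg g₀ < deg g₁`, a non-dense `S(g; Q)` has `Q ∈ ℂ[y₀]`.**
`Q ∈ ℂ[t, y₀, y₁]` irreducible with a zero in `(ℂˣ)²` over infinitely many `t`; if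
`I(S(g; Q) ∩ Γ_exp) ≠ I(S(g; Q))` then no monomial of `Q` involves `t` or `y₁`: the surface is the
constant-fibre cylinder `{(g₀(t), g₁(t))} × {Q(y₀) = 0} × ℂ`.
[cite: MantovaMasser2023, §1 Further remarks, p. 5 (the question, open in general)] (new) -/
theorem paramSurface₃_support_of_not_dense (hd : 2 ≤ g₀.natDegree)
    (hlt : g₀.natDegree < g₁.natDegree) (hirr : Irreducible Q)
    (hfib : Set.Infinite {t : ℂ | ∃ c : Fin 2 → ℂ, c 0 ≠ 0 ∧ c 1 ≠ 0 ∧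
      MvPolynomial.eval ![t, c 0, c 1] Q = 0})
    (hnot : ¬ UnprojectedDense {w : Fin 2 ⊕ Fin 2 → ℂ | ∃ t : ℂ, w (Sum.inl 0) = g₀.eval t ∧
      w (Sum.inl 1) = g₁.eval t ∧
      MvPolynomial.eval (Fin.cases t (fun i => w (Sum.inr i)) : Fin 3 → ℂ) Q = 0}) :
    ∀ m ∈ Q.support, m 0 = 0 ∧ m 2 = 0 := by
  rcases two_y1_degrees_or_y0_of_torusFibres hirr hfib with h2 | ⟨hQ2, h1⟩
  · exact absurd (unprojectedDense_paramSurface₃ g₀ g₁ (by omega) hlt hirr h2) hnot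
  · by_cases hx : ∃ m ∈ Q.support, m 0 ≠ 0
    · exact absurd (unprojectedDense_paramSurface₃_of_y0_of_involves_t g₀ g₁ hd hlt hirr hQ2 h1 hx)
        hnot
    · push Not at hx
      exact fun m hm => ⟨hx m hm, hQ2 m hm⟩

/-- **Positive form**: over a polynomial curve with `2 ≤ deg g₀ < deg g₁`, every `S(g; Q)` with `Q`
irreducible, torus fibres over infinitely many `t`, and a monomial involving `t` or `y₁`, has
Zariski-dense exponential points.
[cite: MantovaMasser2023, §1 Further remarks, p. 5 (the question, open in general)] (new) -/
theorem unprojectedDense_paramSurface₃_of_not_constFibre (hd : 2 ≤ g₀.natDegree)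
    (hlt : g₀.natDegree < g₁.natDegree) (hirr : Irreducible Q)
    (hfib : Set.Infinite {t : ℂ | ∃ c : Fin 2 → ℂ, c 0 ≠ 0 ∧ c 1 ≠ 0 ∧
      MvPolynomial.eval ![t, c 0, c 1] Q = 0})
    (hQ : ∃ m ∈ Q.support, m 0 ≠ 0 ∨ m 2 ≠ 0) :
    UnprojectedDense {w : Fin 2 ⊕ Fin 2 → ℂ | ∃ t : ℂ, w (Sum.inl 0) = g₀.eval t ∧
      w (Sum.inl 1) = g₁.eval t ∧
      MvPolynomial.eval (Fin.cases t (fun i => w (Sum.inr i)) : Fin 3 → ℂ) Q = 0} := by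
  by_contra hnot
  obtain ⟨m, hm, h⟩ := hQ
  obtain ⟨h0, h2⟩ := paramSurface₃_support_of_not_dense g₀ g₁ hd hlt hirr hfib hnot m hm
  exact h.elim (fun h => h h0) (fun h => h h2)

/-! ## Part C. The answer over polynomial curves with `2 ≤ deg g₀ < deg g₁`, and the mirror -/

/-- **Mantova–Masser's density question over a polynomial curve with `2 ≤ deg g₀ < deg g₁`: the
complete answer.**  A surface of their case whose base curve is `{(g₀(t), g₁(t))}` and WITHOUT
Zariski-dense exponential points is a constant-fibre cylinder: `W = S(g; Q)` with `Q ∈ ℂ[y₀]`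
irreducible (no monomial involves `t` or `y₁`).
[cite: MantovaMasser2023, §1 Further remarks, p. 5 (the question, open in general)] (new) -/
theorem mmCase_paramBase_complete (hd : 2 ≤ g₀.natDegree) (hlt : g₀.natDegree < g₁.natDegree)
    {W : Set (Fin 2 ⊕ Fin 2 → ℂ)} (hmm : MMCaseDimPiOneFree W)
    (hbase : zeroLocus ℂ (vanishingIdeal ℂ (projAdd '' (W ∩ torusLocus ℂ 2))) =
      {x : Fin 2 → ℂ | ∃ t : ℂ, x 0 = g₀.eval t ∧ x 1 = g₁.eval t})
    (hnot : ¬ UnprojectedDense W) :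
    ∃ Q : MvPolynomial (Fin 3) ℂ, Irreducible Q ∧
      W = {w : Fin 2 ⊕ Fin 2 → ℂ | ∃ t : ℂ, w (Sum.inl 0) = g₀.eval t ∧ w (Sum.inl 1) = g₁.eval t ∧
        MvPolynomial.eval (Fin.cases t (fun i => w (Sum.inr i)) : Fin 3 → ℂ) Q = 0} ∧
      ∀ m ∈ Q.support, m 0 = 0 ∧ m 2 = 0 := by
  obtain ⟨Q, hQ, hfib, hW⟩ := exists_eq_paramSurface₃_of_mmCase g₀ g₁ (by omega) hmm hbase
  refine ⟨Q, hQ, hW, ?_⟩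
  rw [hW] at hnot
  exact paramSurface₃_support_of_not_dense g₀ g₁ hd hlt hQ hfib hnot

/-- **Every `W` of Mantova–Masser's case over `{(g₀(t), g₁(t))}` (`2 ≤ deg g₀ < deg g₁`) that is
NOT a constant-fibre cylinder `y₀ = θ` has Zariski-dense exponential points** (contrapositive
reading of `mmCase_paramBase_complete`).
[cite: MantovaMasser2023, §1 Further remarks, p. 5 (the question, open in general)] (new) -/
theorem unprojectedDense_of_mmCase_of_base_eq_paramCurve_of_not_constFibre (hd : 2 ≤ g₀.natDegree)
    (hlt : g₀.natDegree < g₁.natDegree) {W : Set (Fin 2 ⊕ Fin 2 → ℂ)} (hmm : MMCaseDimPiOneFree W)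
    (hbase : zeroLocus ℂ (vanishingIdeal ℂ (projAdd '' (W ∩ torusLocus ℂ 2))) =
      {x : Fin 2 → ℂ | ∃ t : ℂ, x 0 = g₀.eval t ∧ x 1 = g₁.eval t})
    (hW : ∀ Q : MvPolynomial (Fin 3) ℂ, Irreducible Q → (∀ m ∈ Q.support, m 0 = 0 ∧ m 2 = 0) →
      W ≠ {w : Fin 2 ⊕ Fin 2 → ℂ | ∃ t : ℂ, w (Sum.inl 0) = g₀.eval t ∧ w (Sum.inl 1) = g₁.eval t ∧
        MvPolynomial.eval (Fin.cases t (fun i => w (Sum.inr i)) : Fin 3 → ℂ) Q = 0}) :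
    UnprojectedDense W := by
  by_contra hnot
  obtain ⟨Q, hQ, hWQ, hsupp⟩ := mmCase_paramBase_complete g₀ g₁ hd hlt hmm hbase hnot
  exact hW Q hQ hsupp hWQ

/-- **Mirror (`2 ≤ deg g₁ < deg g₀`)**: a `W` of the case over `{(g₀(t), g₁(t))}` without
Zariski-dense exponential points is `S(g; Q)` with `Q ∈ ℂ[y₁]` (no monomial involves `t` or `y₀`).
[cite: MantovaMasser2023, §1 Further remarks, p. 5 (the question, open in general)] (new) -/
theorem mmCase_paramBase_complete_of_gt (hd : 2 ≤ g₁.natDegree) (hlt : g₁.natDegree < g₀.natDegree)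
    {W : Set (Fin 2 ⊕ Fin 2 → ℂ)} (hmm : MMCaseDimPiOneFree W)
    (hbase : zeroLocus ℂ (vanishingIdeal ℂ (projAdd '' (W ∩ torusLocus ℂ 2))) =
      {x : Fin 2 → ℂ | ∃ t : ℂ, x 0 = g₀.eval t ∧ x 1 = g₁.eval t})
    (hnot : ¬ UnprojectedDense W) :
    ∃ Q : MvPolynomial (Fin 3) ℂ, Irreducible Q ∧
      W = {w : Fin 2 ⊕ Fin 2 → ℂ | ∃ t : ℂ, w (Sum.inl 0) = g₀.eval t ∧ w (Sum.inl 1) = g₁.eval t ∧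
        MvPolynomial.eval (Fin.cases t (fun i => w (Sum.inr i)) : Fin 3 → ℂ) Q = 0} ∧
      ∀ m ∈ Q.support, m 0 = 0 ∧ m 1 = 0 := by
  classical
  obtain ⟨Q, hQ, hfib, hW⟩ := exists_eq_paramSurface₃_of_mmCase g₀ g₁ (by omega) hmm hbase
  refine ⟨Q, hQ, hW, ?_⟩
  rw [hW, paramSurface₃_eq_indexSwapped, unprojectedDense_indexSwapped_iff] at hnot
  have h := paramSurface₃_support_of_not_dense g₁ g₀ hd hlt (irreducible_rename_swap12 hQ)
    (torusFibres_rename_swap12 hfib) hnot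
  intro m hm
  have hinj : Function.Injective (Equiv.swap (1 : Fin 3) 2) := (Equiv.swap (1 : Fin 3) 2).injective
  have hm' : Finsupp.mapDomain (Equiv.swap (1 : Fin 3) 2) m ∈
      (rename (Equiv.swap (1 : Fin 3) 2) Q).support := by
    rw [support_rename_of_injective hinj]; exact Finset.mem_image_of_mem _ hm
  obtain ⟨h0, h2⟩ := h _ hm'
  have e0 : Finsupp.mapDomain (Equiv.swap (1 : Fin 3) 2) m 0 = m 0 := by
    have h := Finsupp.mapDomain_apply hinj m 0
    rwa [show Equiv.swap (1 : Fin 3) 2 0 = 0 from rfl] at h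
  have e2 : Finsupp.mapDomain (Equiv.swap (1 : Fin 3) 2) m 2 = m 1 := by
    have h := Finsupp.mapDomain_apply hinj m 1
    rwa [Equiv.swap_apply_left] at h
  exact ⟨e0 ▸ h0, e2 ▸ h2⟩

end Main

/-! ## Part D. Plain coordinates: fibre curves `P(t, y₀) = 0`, and the example `(t², i t⁴ + t)` -/

section Plain

variable (g₀ g₁ : Polynomial ℂ) {P : MvPolynomial (Fin 2) ℂ}

/-- **Zariski density for fibre curves `P(t, y₀) = 0` involving `t` over a polynomial curve with
`2 ≤ deg g₀ < deg g₁` — no phase condition.**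
[cite: MantovaMasser2023, §1 Further remarks, p. 5 (the question, open in general)] (new) -/
theorem unprojectedDense_paramFibreCurve_of_involves_t (hd : 2 ≤ g₀.natDegree)
    (hlt : g₀.natDegree < g₁.natDegree) (hirr : Irreducible P)
    (h1 : ∃ v ∈ P.support, ∃ v' ∈ P.support, v 1 ≠ v' 1) (hx : ∃ v ∈ P.support, v 0 ≠ 0) :
    UnprojectedDense {w : Fin 2 ⊕ Fin 2 → ℂ | ∃ t : ℂ, w (Sum.inl 0) = g₀.eval t ∧
      w (Sum.inl 1) = g₁.eval t ∧ MvPolynomial.eval ![t, w (Sum.inr 0)] P = 0} := by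
  rw [paramFibreCurveSurface_eq]
  exact unprojectedDense_paramSurface₃_of_y0_of_involves_t g₀ g₁ hd hlt
    (irreducible_rename_castSucc₂ hirr) (support_rename_castSucc_y1 P)
    (exists_support_rename_castSucc_y0 h1) ((exists_support_rename_castSucc_iff (fun a _ => a ≠ 0)).2 hx)

/-- **Case ∧ dense** for such fibre curves with, in addition, a nonzero fibre root over infinitely
many `t`. [cite: MantovaMasser2023, §1 Further remarks, p. 5 (the question, open in general)] (new) -/
theorem unprojectedDensityQuestion_instance_paramFibreCurve_of_involves_t (hd : 2 ≤ g₀.natDegree)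
    (hlt : g₀.natDegree < g₁.natDegree) (hirr : Irreducible P)
    (h1 : ∃ v ∈ P.support, ∃ v' ∈ P.support, v 1 ≠ v' 1) (hx : ∃ v ∈ P.support, v 0 ≠ 0)
    (hfib : Set.Infinite {t : ℂ | ∃ y : ℂ, y ≠ 0 ∧ MvPolynomial.eval ![t, y] P = 0}) :
    MMCaseDimPiOneFree {w : Fin 2 ⊕ Fin 2 → ℂ | ∃ t : ℂ, w (Sum.inl 0) = g₀.eval t ∧
        w (Sum.inl 1) = g₁.eval t ∧ MvPolynomial.eval ![t, w (Sum.inr 0)] P = 0} ∧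
      UnprojectedDense {w : Fin 2 ⊕ Fin 2 → ℂ | ∃ t : ℂ, w (Sum.inl 0) = g₀.eval t ∧
        w (Sum.inl 1) = g₁.eval t ∧ MvPolynomial.eval ![t, w (Sum.inr 0)] P = 0} := by
  refine ⟨?_, unprojectedDense_paramFibreCurve_of_involves_t g₀ g₁ hd hlt hirr h1 hx⟩
  rw [paramFibreCurveSurface_eq]
  refine mmCase_paramSurface₃_of_y0 g₀ g₁ (by omega)
    (paramCurve_indep_of_ne g₀ g₁ (by omega) (by omega) (by omega)) (irreducible_rename_castSucc₂ hirr)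
    (hfib.mono ?_)
  rintro t ⟨y, hy, hty⟩
  exact ⟨y, hy, by rw [eval_vec3_rename_castSucc]; exact hty⟩

/-- `deg (i X⁴ + X) = 4`. -/
theorem natDegree_C_I_mul_X_pow_four_add_X :
    (Polynomial.C I * Polynomial.X ^ 4 + Polynomial.X : Polynomial ℂ).natDegree = 4 := by
  rw [Polynomial.natDegree_add_eq_left_of_natDegree_lt] <;>
    simp [Polynomial.natDegree_C_mul_X_pow 4 I I_ne_zero]

/-- **Example (a member of the former residual class).**  The surface `{(t², i t⁴ + t, y₀, y₁) :
y₀ = t}` — base curve `(t², i t⁴ + t)`: `2 ∣ 4`, vanishing phase, no gap — is in Mantova–Masser's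
case and its exponential points are Zariski dense. (new) -/
theorem unprojectedDensityQuestion_instance_iQuarticLinear_y0_eq_t :
    MMCaseDimPiOneFree {w : Fin 2 ⊕ Fin 2 → ℂ | ∃ t : ℂ,
        w (Sum.inl 0) = (Polynomial.X ^ 2 : Polynomial ℂ).eval t ∧
        w (Sum.inl 1) = (Polynomial.C I * Polynomial.X ^ 4 + Polynomial.X : Polynomial ℂ).eval t ∧
        MvPolynomial.eval ![t, w (Sum.inr 0)] (X 1 - X 0 : MvPolynomial (Fin 2) ℂ) = 0} ∧
      UnprojectedDense {w : Fin 2 ⊕ Fin 2 → ℂ | ∃ t : ℂ,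
        w (Sum.inl 0) = (Polynomial.X ^ 2 : Polynomial ℂ).eval t ∧
        w (Sum.inl 1) = (Polynomial.C I * Polynomial.X ^ 4 + Polynomial.X : Polynomial ℂ).eval t ∧
        MvPolynomial.eval ![t, w (Sum.inr 0)] (X 1 - X 0 : MvPolynomial (Fin 2) ℂ) = 0} := by
  refine unprojectedDensityQuestion_instance_paramFibreCurve_of_involves_t _ _ (by simp)
    (by rw [natDegree_C_I_mul_X_pow_four_add_X]; simp) irreducible_X1_sub_X0 X1_sub_X0_support_pair
    ?_ X1_sub_X0_fibres_infinite
  -- the monomial `t` of `y₀ - t` involves `t`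
  classical
  have hne : (Finsupp.single (1 : Fin 2) 1 : Fin 2 →₀ ℕ) ≠ Finsupp.single 0 1 := by
    intro h; have := DFunLike.congr_fun h 1; simp at this
  refine ⟨Finsupp.single 0 1, ?_, by simp⟩
  rw [MvPolynomial.mem_support_iff, MvPolynomial.coeff_sub, MvPolynomial.coeff_X,
    MvPolynomial.coeff_X, if_neg hne, if_pos rfl]
  norm_num

/-- The same surface in plain coordinates: **`{x₀ = y₀², x₁ = i y₀⁴ + y₀}` has Zariski-dense
exponential points.** (new) -/
theorem unprojectedDense_x0_eq_y0sq_x1_eq_I_y0four_add_y0 :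
    UnprojectedDense {w : Fin 2 ⊕ Fin 2 → ℂ |
      w (Sum.inl 0) = w (Sum.inr 0) ^ 2 ∧ w (Sum.inl 1) = I * w (Sum.inr 0) ^ 4 + w (Sum.inr 0)} := by
  have h := unprojectedDensityQuestion_instance_iQuarticLinear_y0_eq_t.2
  have hset : {w : Fin 2 ⊕ Fin 2 → ℂ | ∃ t : ℂ,
        w (Sum.inl 0) = (Polynomial.X ^ 2 : Polynomial ℂ).eval t ∧
        w (Sum.inl 1) = (Polynomial.C I * Polynomial.X ^ 4 + Polynomial.X : Polynomial ℂ).eval t ∧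
        MvPolynomial.eval ![t, w (Sum.inr 0)] (X 1 - X 0 : MvPolynomial (Fin 2) ℂ) = 0} =
      {w : Fin 2 ⊕ Fin 2 → ℂ |
        w (Sum.inl 0) = w (Sum.inr 0) ^ 2 ∧ w (Sum.inl 1) = I * w (Sum.inr 0) ^ 4 + w (Sum.inr 0)} := by
    ext w
    simp only [Set.mem_setOf_eq, Polynomial.eval_pow, Polynomial.eval_X, Polynomial.eval_add,
      Polynomial.eval_mul, Polynomial.eval_C, map_sub, MvPolynomial.eval_X, Matrix.cons_val_one,
      Matrix.cons_val_zero, Matrix.cons_val_fin_one, sub_eq_zero]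
    constructor
    · rintro ⟨t, h0, h1, rfl⟩
      exact ⟨h0, h1⟩
    · rintro ⟨h0, h1⟩
      exact ⟨w (Sum.inr 0), h0, h1, rfl⟩
  rw [← hset]
  exact h

end Plain

end Summit.Schanuel.Schanuel.Theorems
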